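import Literature.Computability.Complexity.SpaceLoop
import Mathlib.Tactic.DeriveFintype
import HarnessLib

/-!
# The query transducer of a space machine: answering one oracle query in place

Trunk toolkit for `Space.lean` / `SpaceLoop.lean` / `SpaceLoopBounded.lean`, towards the named
facts of `SpaceOracles.lean` (`∃ᵖ·PSPACE ⊆ PSPACE`, `P^PSPACE ⊆ PSPACE`; Homer–Selman 2011,
Thm. 5.10 / Cor. 5.7 and the proof of Prop. 7.5, "`NP^PSPACE = PSPACE`"). A polynomial-space
algorithm that consults a language `A ∈ PSPACE` answers each query by re-running the space-bounded
decider of `A` in place (Arora–Barak 2009, §4.1: space is reused; Hirahara–Lu–Ren 2023, Rem. 2: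
`PSPACE^PSPACE = PSPACE`). This file builds that device once, as a bundled multi-stack machine:

* `SpaceQuery.queryTM N` — the **query transducer** of an input-preserving space machine
  `N : SpaceMachine Bool Bool` (`Space.lean`): a `Turing.FinTM2` with stacks `N.tm.K ⊕ QAux`
  (all stacks of `N` become work stacks; the Boolean stack `IO` is both input and output stack,
  `TMP` is a transfer stack), labels `N.tm.Λ ⊕ QCtrl`, states `N.tm.σ × Option Bool`. On the
  input word `0 q` it runs `N` on `q` and halts with `0 b q` on `IO`, where `[b]` is the output of
  `N` on `q` (so `b = [q ∈ A]` when `N` decides `A`); every other input word is returned unchanged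
  (`SpaceQuery.answerFn A`). It halts in Mathlib's `haltList` normal form (all other stacks
  empty, state reset), so that it composes (`TM2Comp.compTM`) with the polynomial-time machine of
  a round function and iterates under the loop machine of `SpaceLoop.lean`.
* Control flow (`SpaceQuery.ctrlStmt`): `test` (inspect the flag), `mvQ` (`IO → TMP`), `feedN`
  (`TMP →` input stack of `N`, restoring the order), the program of `N` (`SpaceQuery.trStmt`,
  `halt ↦ goto testN`), `testN` (read the answer of `N`, park it at the bottom of `TMP`), `restore`
  (left input stack of `N →` its input stack: by input preservation this re-assembles `q`), `mvN`
  (input stack of `N → TMP`), `pourBack` (`TMP → IO`, then push the flag `0`), `clear` (pop every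
  stack of `N` once per round until a round pops nothing — the halting configuration of a space
  machine may hold junk —, then reset the state and halt).
* This file: the machine, its single steps and its phases as runs through an arbitrary predicate
  (`SpaceLoop.RunsVia`); the complete trajectory, the space accounting and the packaging as
  `SpaceLoop.SpaceRuns` are in `SpaceQueryMachineRun.lean`.

## References

* S. Homer, A. L. Selman, *Computability and Complexity Theory*, 2nd ed., Springer 2011,
  Thm. 5.10, Cor. 5.7, proof of Prop. 7.5. [HomerSelman2011]
* S. Arora, B. Barak, *Computational Complexity: A Modern Approach*, CUP 2009, Def. 4.1, §4.1,
  §3.4 (oracle machines). [AroraBarak2009]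
* S. Hirahara, Z. Lu, H. Ren, *Bounded relativization*, CCC 2023, Rem. 2. [HiraharaLuRen2023]
* Mathlib, `Mathlib/Computability/TuringMachine/Computable.lean` (`FinTM2`, `initList`,
  `haltList`).

## Design notes

* `IO` is both `k₀` and `k₁` of the transducer (Mathlib's `FinTM2` allows this), so that words
  not of the form `0 q` cost one step and no copying.
* The answer bit is parked at the BOTTOM of `TMP` before `q` is poured over it, so that no
  register has to survive a loop; the flag `0` is a constant push at the end.
* `clear` is ONE label whose statement pops all stacks of `N` (a fold over `Finset.univ.toList`),
  recording in the register whether anything was popped.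
-/

namespace Literature.Computability.Complexity

namespace SpaceQuery

open Turing StateTransition Function TM2Comp SpaceLoop

/-! ### Auxiliary stacks, control labels, alphabets -/

/-- The two auxiliary stacks of the query transducer: the input/output stack `IO` and the
transfer stack `TMP` (both over `Bool`). [folklore] -/
inductive QAux
  | IO
  | TMP
  deriving DecidableEq, Fintype

/-- The control labels of the query transducer (besides the labels of the embedded space
machine). [folklore] -/
inductive QCtrl
  | test
  | mvQ
  | feedN
  | testN
  | restore
  | mvN
  | pourBack
  | clear
  deriving DecidableEq, Fintype

section Machine

variable {K : Type} {G : K → Type} {Λ σ : Type}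

/-- Stack alphabets of the query transducer: those of the embedded machine on `inl`, `Bool` on
the auxiliary stacks (a `casesOn`, unfolding by `rfl` on constructors). [folklore] -/
abbrev QΓ (G : K → Type) : K ⊕ QAux → Type := fun j =>
  Sum.casesOn (motive := fun _ => Type) j G (fun _ => Bool)

/-- Internal states of the query transducer: a state of the embedded machine and one register.
[folklore] -/
abbrev QSt (σ : Type) : Type := σ × Option Bool

/-- Reset the register. [folklore] -/
def qrst : QSt σ → QSt σ := fun v => (v.1, none)

/-- Stack contents of the query transducer from the stacks `S` of the embedded machine and the
contents `io`, `t` of `IO`, `TMP`. [folklore] -/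
def mkStk (S : ∀ k, List (G k)) (io t : List Bool) : ∀ j : K ⊕ QAux, List (QΓ G j)
  | Sum.inl k => S k
  | Sum.inr QAux.IO => io
  | Sum.inr QAux.TMP => t

section StkLemmas

variable (S : ∀ k, List (G k)) (io t : List Bool)

/-- Reading a stack of the embedded machine. [folklore] -/
@[simp] theorem mkStk_inl (k : K) : mkStk S io t (Sum.inl k) = S k := rfl
/-- Reading `IO`. [folklore] -/
@[simp] theorem mkStk_IO : mkStk S io t (Sum.inr QAux.IO) = io := rfl
/-- Reading `TMP`. [folklore] -/
@[simp] theorem mkStk_TMP : mkStk S io t (Sum.inr QAux.TMP) = t := rfl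

variable {dKA : DecidableEq (K ⊕ QAux)}

/-- Writing a stack of the embedded machine (any decidability instance on `K ⊕ QAux`, so that
the lemma also fires on the instance bundled in a `FinTM2`). [folklore] -/
@[simp] theorem mkStk_update_inl [DecidableEq K] (k : K) (L : List (G k)) :
    @update _ _ dKA (mkStk S io t) (Sum.inl k) L = mkStk (update S k L) io t := by
  funext j
  rcases j with k' | a
  · rcases eq_or_ne k' k with rfl | h
    · simp
    · rw [update_of_ne (by simpa using h)]; simp [update_of_ne h]
  · rw [update_of_ne (by simp)]; cases a <;> rfl

/-- Writing `IO`. [folklore] -/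
@[simp] theorem mkStk_update_IO (io' : List Bool) :
    @update _ _ dKA (mkStk S io t) (Sum.inr QAux.IO) io' = mkStk S io' t := by
  funext j
  rcases j with k' | a
  · rw [update_of_ne (by simp)]; rfl
  · cases a
    · simp
    · rw [update_of_ne (by simp)]; rfl

/-- Writing `TMP`. [folklore] -/
@[simp] theorem mkStk_update_TMP (t' : List Bool) :
    @update _ _ dKA (mkStk S io t) (Sum.inr QAux.TMP) t' = mkStk S io t' := by
  funext j
  rcases j with k' | a
  · rw [update_of_ne (by simp)]; rfl
  · cases a
    · rw [update_of_ne (by simp)]; rfl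
    · simp

/-- The empty stack assignment. [folklore] -/
theorem mkStk_bot :
    mkStk (fun k => ([] : List (G k))) [] [] = fun j => ([] : List (QΓ G j)) := by
  funext j
  rcases j with k | a
  · rfl
  · cases a <;> rfl

/-- A stack assignment supported on `IO`. [folklore] -/
theorem mkStk_bot_IO [DecidableEq K] (l : List Bool) :
    mkStk (fun k => ([] : List (G k))) l [] =
      update (fun j => ([] : List (QΓ G j))) (Sum.inr QAux.IO) l := by
  rw [← mkStk_bot, mkStk_update_IO]

end StkLemmas

/-! ### The embedded program -/

/-- Translation of the statements of the embedded machine: act on the `inl` stacks and the first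
state component; `halt` becomes a jump to the control label `testN`. [folklore] -/
def trStmt : TM2.Stmt G Λ σ → TM2.Stmt (QΓ G) (Λ ⊕ QCtrl) (QSt σ)
  | TM2.Stmt.push k f q => TM2.Stmt.push (Sum.inl k) (fun s => f s.1) (trStmt q)
  | TM2.Stmt.peek k f q => TM2.Stmt.peek (Sum.inl k) (fun s x => (f s.1 x, s.2)) (trStmt q)
  | TM2.Stmt.pop k f q => TM2.Stmt.pop (Sum.inl k) (fun s x => (f s.1 x, s.2)) (trStmt q)
  | TM2.Stmt.load f q => TM2.Stmt.load (fun s => (f s.1, s.2)) (trStmt q)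
  | TM2.Stmt.branch p q₁ q₂ => TM2.Stmt.branch (fun s => p s.1) (trStmt q₁) (trStmt q₂)
  | TM2.Stmt.goto l => TM2.Stmt.goto fun s => Sum.inl (l s.1)
  | TM2.Stmt.halt => TM2.Stmt.goto fun _ => Sum.inr QCtrl.testN

/-- Configuration of the query transducer while the embedded machine runs: `IO` and `TMP` are
empty, the register is reset, the halting label is sent to `testN`. [folklore] -/
def cfgN (c : TM2.Cfg G Λ σ) : TM2.Cfg (QΓ G) (Λ ⊕ QCtrl) (QSt σ) :=
  ⟨some (c.l.elim (Sum.inr QCtrl.testN) Sum.inl), (c.var, none), mkStk c.stk [] []⟩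

/-- One statement of the embedded machine is simulated exactly by its translation. [folklore] -/
theorem stepAux_trStmt [DecidableEq K] (q : TM2.Stmt G Λ σ) (v : σ) (S : ∀ k, List (G k)) :
    TM2.stepAux (trStmt q) ((v, none) : QSt σ) (mkStk S [] []) = cfgN (TM2.stepAux q v S) := by
  induction q generalizing v S with
  | push k f q ih =>
    simp only [trStmt, TM2.stepAux]
    rw [← ih, mkStk_inl, mkStk_update_inl]
  | peek k f q ih => simp only [trStmt, TM2.stepAux]; exact ih _ _
  | pop k f q ih =>
    simp only [trStmt, TM2.stepAux]
    rw [← ih, mkStk_inl, mkStk_update_inl]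
  | load f q ih => simp only [trStmt, TM2.stepAux]; exact ih _ _
  | branch p q₁ q₂ ih₁ ih₂ =>
    simp only [trStmt, TM2.stepAux]
    cases p v
    · exact ih₂ _ _
    · exact ih₁ _ _
  | goto l => rfl
  | halt => rfl

/-! ### Clearing all stacks of the embedded machine -/

section Clear

variable [DecidableEq K]

/-- Popping each of the listed stacks once (in order). [folklore] -/
def popAll : List K → (∀ k, List (G k)) → ∀ k, List (G k)
  | [], S => S
  | k :: ks, S => popAll ks (update S k (S k).tail)

/-- Whether one of the listed stacks is nonempty when it is popped in order. [folklore] -/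
def anyNE : List K → (∀ k, List (G k)) → Bool
  | [], _ => false
  | k :: ks, S => (S k).head?.isSome || anyNE ks (update S k (S k).tail)

/-- The multi-pop statement: pop each listed stack of the embedded machine once, setting the
register to `some true` if anything was popped, then continue with `q`. [folklore] -/
def clearStmt (q : TM2.Stmt (QΓ G) (Λ ⊕ QCtrl) (QSt σ)) :
    List K → TM2.Stmt (QΓ G) (Λ ⊕ QCtrl) (QSt σ)
  | [] => q
  | k :: ks => TM2.Stmt.pop (Sum.inl k) (fun v a => (v.1, bif a.isSome then some true else v.2))
      (clearStmt q ks)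

/-- Semantics of the multi-pop statement. [folklore] -/
theorem stepAux_clearStmt (q : TM2.Stmt (QΓ G) (Λ ⊕ QCtrl) (QSt σ)) (ks : List K) (s : σ)
    (r : Option Bool) (S : ∀ k, List (G k)) (io t : List Bool) :
    TM2.stepAux (clearStmt q ks) ((s, r) : QSt σ) (mkStk S io t) =
      TM2.stepAux q (s, bif anyNE ks S then some true else r) (mkStk (popAll ks S) io t) := by
  induction ks generalizing r S with
  | nil => rfl
  | cons k ks ih =>
    simp only [clearStmt, TM2.stepAux, mkStk_inl, mkStk_update_inl]
    rw [ih]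
    simp only [anyNE, popAll]
    cases (S k).head?.isSome <;> cases anyNE ks (update S k (S k).tail) <;> rfl

/-- Popping never lengthens a stack. [folklore] -/
theorem length_popAll_le (ks : List K) (S : ∀ k, List (G k)) (k : K) :
    (popAll ks S k).length ≤ (S k).length := by
  induction ks generalizing S with
  | nil => exact le_rfl
  | cons k' ks ih =>
    refine (ih _).trans ?_
    rcases eq_or_ne k k' with rfl | h
    · simp
    · rw [update_of_ne h]

/-- If a round pops nothing, every listed stack was empty. [folklore] -/
theorem eq_nil_of_anyNE_eq_false {ks : List K} {S : ∀ k, List (G k)} (h : anyNE ks S = false)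
    {k : K} (hk : k ∈ ks) : S k = [] := by
  induction ks generalizing S with
  | nil => cases hk
  | cons k' ks ih =>
    simp only [anyNE, Bool.or_eq_false_iff] at h
    have hk' : S k' = [] := by
      cases h' : S k' with
      | nil => rfl
      | cons a l => rw [h'] at h; simp at h
    have htl : (S k').tail = S k' := by rw [hk']; rfl
    have hS : update S k' (S k').tail = S := by
      rw [htl]; exact update_eq_self k' S
    rw [hS] at h
    rcases List.mem_cons.1 hk with rfl | hk
    · exact hk'
    · exact ih h.2 hk

/-- If a round pops nothing, the stacks are unchanged. [folklore] -/
theorem popAll_eq_self_of_anyNE_eq_false {ks : List K} {S : ∀ k, List (G k)}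
    (h : anyNE ks S = false) : popAll ks S = S := by
  induction ks generalizing S with
  | nil => rfl
  | cons k' ks ih =>
    have hk' : S k' = [] := eq_nil_of_anyNE_eq_false h (List.mem_cons_self ..)
    simp only [anyNE, Bool.or_eq_false_iff] at h
    have htl : (S k').tail = S k' := by rw [hk']; rfl
    have hS : update S k' (S k').tail = S := by
      rw [htl]; exact update_eq_self k' S
    simp only [popAll, hS] at h ⊢
    exact ih h.2

/-- If a round pops something, the total length of the listed stacks (counted with a finite
index type) strictly decreases. [folklore] -/
theorem sum_length_popAll_lt [Fintype K] {ks : List K} {S : ∀ k, List (G k)}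
    (h : anyNE ks S = true) :
    ∑ k, (popAll ks S k).length < ∑ k, (S k).length := by
  induction ks generalizing S with
  | nil => simp [anyNE] at h
  | cons k' ks ih =>
    simp only [anyNE, Bool.or_eq_true] at h
    simp only [popAll]
    have hle : ∑ k, (update S k' (S k').tail k).length ≤ ∑ k, (S k).length :=
      Finset.sum_le_sum fun k _ => length_update_tail_le S k' k
    rcases h with h | h
    · refine lt_of_le_of_lt (Finset.sum_le_sum fun k _ => length_popAll_le ks _ k) ?_
      have hne : S k' ≠ [] := by
        intro h0; rw [h0] at h; simp at h
      have hlt : (update S k' (S k').tail k').length < (S k').length := by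
        simp only [update_self, List.length_tail]
        have := List.length_pos_of_ne_nil hne
        omega
      exact Finset.sum_lt_sum (fun k _ => length_update_tail_le S k' k) ⟨k', Finset.mem_univ _, hlt⟩
    · exact lt_of_lt_of_le (ih h) hle

end Clear

/-! ### The control statements -/

variable (kI kL kO : K) (eI : G kI ≃ Bool) (eL : G kL ≃ Bool) (eO : G kO ≃ Bool)
  (main : Λ) (init : σ) (ks : List K)

/-- The control statements of the query transducer (see the module docstring):
* `test`: pop the flag from `IO`; empty input → halt; flag `1` → push it back and halt; flag
  `0` → `mvQ`;
* `mvQ`: pour `IO` onto `TMP`; then `feedN`: pour `TMP` onto the input stack `kI` of the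
  embedded machine (through `eI.symm`) and start it;
* `testN` (reached when the embedded machine halts): read its answer, the top of `kO`
  (through `eO`; the symbol stays, `kO` may be the input stack `kI`), and park it on `TMP`; `restore`: pour the left input stack `kL` onto `kI` (through `eL`,
  `eI.symm`); `mvN`: pour `kI` onto `TMP` (through `eI`); `pourBack`: pour `TMP` onto `IO` and
  push the flag `0`;
* `clear`: pop every listed stack once; if anything was popped, again; otherwise reset the
  state and halt.
[cite: HomerSelman2011, Thm. 5.10 and proof of Prop. 7.5 (re-running a space-bounded machine in place)] -/
def ctrlStmt [DecidableEq K] : QCtrl → TM2.Stmt (QΓ G) (Λ ⊕ QCtrl) (QSt σ)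
  | QCtrl.test =>
      TM2.Stmt.pop (Sum.inr QAux.IO) (fun v a => (v.1, a)) <|
        TM2.Stmt.branch (fun v => v.2.isNone)
          (TM2.Stmt.load qrst TM2.Stmt.halt)
          (TM2.Stmt.branch (fun v => v.2.getD false)
            (TM2.Stmt.push (Sum.inr QAux.IO) (fun _ => true) <| TM2.Stmt.load qrst TM2.Stmt.halt)
            (TM2.Stmt.load qrst <| TM2.Stmt.goto fun _ => Sum.inr QCtrl.mvQ))
  | QCtrl.mvQ =>
      TM2.Stmt.pop (Sum.inr QAux.IO) (fun v a => (v.1, a)) <|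
        TM2.Stmt.branch (fun v => v.2.isNone)
          (TM2.Stmt.load qrst <| TM2.Stmt.goto fun _ => Sum.inr QCtrl.feedN)
          (TM2.Stmt.push (Sum.inr QAux.TMP) (fun v => v.2.getD false) <| TM2.Stmt.load qrst <|
            TM2.Stmt.goto fun _ => Sum.inr QCtrl.mvQ)
  | QCtrl.feedN =>
      TM2.Stmt.pop (Sum.inr QAux.TMP) (fun v a => (v.1, a)) <|
        TM2.Stmt.branch (fun v => v.2.isNone)
          (TM2.Stmt.load qrst <| TM2.Stmt.goto fun _ => Sum.inl main)
          (TM2.Stmt.push (Sum.inl kI) (fun v => eI.symm (v.2.getD false)) <| TM2.Stmt.load qrst <|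
            TM2.Stmt.goto fun _ => Sum.inr QCtrl.feedN)
  | QCtrl.testN =>
      TM2.Stmt.peek (Sum.inl kO) (fun v a => (v.1, a.map eO)) <|
        TM2.Stmt.push (Sum.inr QAux.TMP) (fun v => v.2.getD false) <| TM2.Stmt.load qrst <|
          TM2.Stmt.goto fun _ => Sum.inr QCtrl.restore
  | QCtrl.restore =>
      TM2.Stmt.pop (Sum.inl kL) (fun v a => (v.1, a.map eL)) <|
        TM2.Stmt.branch (fun v => v.2.isNone)
          (TM2.Stmt.load qrst <| TM2.Stmt.goto fun _ => Sum.inr QCtrl.mvN)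
          (TM2.Stmt.push (Sum.inl kI) (fun v => eI.symm (v.2.getD false)) <| TM2.Stmt.load qrst <|
            TM2.Stmt.goto fun _ => Sum.inr QCtrl.restore)
  | QCtrl.mvN =>
      TM2.Stmt.pop (Sum.inl kI) (fun v a => (v.1, a.map eI)) <|
        TM2.Stmt.branch (fun v => v.2.isNone)
          (TM2.Stmt.load qrst <| TM2.Stmt.goto fun _ => Sum.inr QCtrl.pourBack)
          (TM2.Stmt.push (Sum.inr QAux.TMP) (fun v => v.2.getD false) <| TM2.Stmt.load qrst <|
            TM2.Stmt.goto fun _ => Sum.inr QCtrl.mvN)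
  | QCtrl.pourBack =>
      TM2.Stmt.pop (Sum.inr QAux.TMP) (fun v a => (v.1, a)) <|
        TM2.Stmt.branch (fun v => v.2.isNone)
          (TM2.Stmt.push (Sum.inr QAux.IO) (fun _ => false) <| TM2.Stmt.load qrst <|
            TM2.Stmt.goto fun _ => Sum.inr QCtrl.clear)
          (TM2.Stmt.push (Sum.inr QAux.IO) (fun v => v.2.getD false) <| TM2.Stmt.load qrst <|
            TM2.Stmt.goto fun _ => Sum.inr QCtrl.pourBack)
  | QCtrl.clear =>
      clearStmt
        (TM2.Stmt.branch (fun v => v.2.isSome)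
          (TM2.Stmt.load qrst <| TM2.Stmt.goto fun _ => Sum.inr QCtrl.clear)
          (TM2.Stmt.load (fun _ => (init, none)) TM2.Stmt.halt)) ks

end Machine

/-! ### Bundling: the query transducer as a `FinTM2` -/

section Bundled

variable (N : SpaceMachine Bool Bool)

/-- The (unbundled) type of configurations of the query transducer. [folklore] -/
abbrev QCfg : Type := TM2.Cfg (QΓ N.tm.Γ) (N.tm.Λ ⊕ QCtrl) (QSt N.tm.σ)

/-- Configurations of the query transducer with reset register, from the label, the state and
the stacks of the embedded machine and the two auxiliary stacks. [folklore] -/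
def cfg (l : Option (N.tm.Λ ⊕ QCtrl)) (s : N.tm.σ) (S : ∀ k, List (N.tm.Γ k)) (io t : List Bool) :
    QCfg N :=
  ⟨l, (s, none), mkStk S io t⟩

/-- The list of all stacks of the embedded machine (in some order). [folklore] -/
noncomputable def allStacks : List N.tm.K := letI := N.tm.kFin; Finset.univ.toList

/-- Every stack of the embedded machine is listed. [folklore] -/
theorem mem_allStacks (k : N.tm.K) : k ∈ allStacks N := by
  letI := N.tm.kFin
  simp [allStacks]

/-- **The query transducer** of an input-preserving space machine `N` (see the module
docstring): stacks `N.tm.K ⊕ QAux` with `IO` as input and output stack, labels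
`N.tm.Λ ⊕ QCtrl` with main label `test`, states `N.tm.σ × Option Bool`.
[cite: HomerSelman2011, Thm. 5.10 and proof of Prop. 7.5] -/
noncomputable def queryTM : FinTM2 :=
  letI := N.tm.kFin; letI := N.tm.ΛFin; letI := N.tm.σFin
  { K := N.tm.K ⊕ QAux
    k₀ := Sum.inr QAux.IO
    k₁ := Sum.inr QAux.IO
    Γ := QΓ N.tm.Γ
    Λ := N.tm.Λ ⊕ QCtrl
    main := Sum.inr QCtrl.test
    σ := QSt N.tm.σ
    initialState := (N.tm.initialState, none)
    Γk₀Fin := (inferInstance : Fintype Bool)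
    m := fun l => match l with
      | Sum.inl l => trStmt (N.tm.m l)
      | Sum.inr c => ctrlStmt N.tm.k₀ N.kL N.tm.k₁ N.inputAlphabet N.leftAlphabet N.outputAlphabet
          N.tm.main N.tm.initialState (allStacks N) c }

/-- A step of the query transducer at a control label, unbundled. [folklore] -/
theorem step_inr (c : QCtrl) (var : QSt N.tm.σ) (stk : ∀ j, List (QΓ N.tm.Γ j)) :
    (queryTM N).step (⟨some (Sum.inr c), var, stk⟩ : QCfg N) =
      some (TM2.stepAux (ctrlStmt N.tm.k₀ N.kL N.tm.k₁ N.inputAlphabet N.leftAlphabet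
        N.outputAlphabet N.tm.main N.tm.initialState (allStacks N) c) var stk) :=
  rfl

/-- A step of the query transducer at a label of the embedded machine, unbundled. [folklore] -/
theorem step_inl (l : N.tm.Λ) (var : QSt N.tm.σ) (stk : ∀ j, List (QΓ N.tm.Γ j)) :
    (queryTM N).step (⟨some (Sum.inl l), var, stk⟩ : QCfg N) =
      some (TM2.stepAux (trStmt (N.tm.m l)) var stk) :=
  rfl

/-- The halted query transducer does not move. [folklore] -/
theorem step_none (var : QSt N.tm.σ) (stk : ∀ j, List (QΓ N.tm.Γ j)) :
    (queryTM N).step (⟨none, var, stk⟩ : QCfg N) = none :=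
  rfl

/-! ### Single steps of the control labels -/

section Steps

variable (s : N.tm.σ) (S : ∀ k, List (N.tm.Γ k)) (io t : List Bool)

/-- `test` on an empty input: halt. [folklore] -/
theorem step_test_nil :
    (queryTM N).step (cfg N (some (Sum.inr QCtrl.test)) s S [] t) = some (cfg N none s S [] t) := by
  rw [cfg, step_inr]; simp [ctrlStmt, qrst, cfg]

/-- `test` on a word flagged `1`: leave it and halt. [folklore] -/
theorem step_test_true :
    (queryTM N).step (cfg N (some (Sum.inr QCtrl.test)) s S (true :: io) t) =
      some (cfg N none s S (true :: io) t) := by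
  rw [cfg, step_inr]; simp [ctrlStmt, qrst, cfg]

/-- `test` on a word flagged `0`: consume the flag and go to `mvQ`. [folklore] -/
theorem step_test_false :
    (queryTM N).step (cfg N (some (Sum.inr QCtrl.test)) s S (false :: io) t) =
      some (cfg N (some (Sum.inr QCtrl.mvQ)) s S io t) := by
  rw [cfg, step_inr]; simp [ctrlStmt, qrst, cfg]

/-- `mvQ` on nonempty `IO`: move one symbol to `TMP`. [folklore] -/
theorem step_mvQ_cons (b : Bool) :
    (queryTM N).step (cfg N (some (Sum.inr QCtrl.mvQ)) s S (b :: io) t) =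
      some (cfg N (some (Sum.inr QCtrl.mvQ)) s S io (b :: t)) := by
  rw [cfg, step_inr]; simp [ctrlStmt, qrst, cfg]

/-- `mvQ` on empty `IO`: go to `feedN`. [folklore] -/
theorem step_mvQ_nil :
    (queryTM N).step (cfg N (some (Sum.inr QCtrl.mvQ)) s S [] t) =
      some (cfg N (some (Sum.inr QCtrl.feedN)) s S [] t) := by
  rw [cfg, step_inr]; simp [ctrlStmt, qrst, cfg]

/-- `feedN` on nonempty `TMP`: move one symbol to the input stack of `N`. [folklore] -/
theorem step_feedN_cons (b : Bool) :
    (queryTM N).step (cfg N (some (Sum.inr QCtrl.feedN)) s S io (b :: t)) =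
      some (cfg N (some (Sum.inr QCtrl.feedN)) s
        (update S N.tm.k₀ (N.inputAlphabet.symm b :: S N.tm.k₀)) io t) := by
  rw [cfg, step_inr]; simp [ctrlStmt, qrst, cfg]

/-- `feedN` on empty `TMP`: start the embedded machine. [folklore] -/
theorem step_feedN_nil :
    (queryTM N).step (cfg N (some (Sum.inr QCtrl.feedN)) s S io []) =
      some (cfg N (some (Sum.inl N.tm.main)) s S io []) := by
  rw [cfg, step_inr]; simp [ctrlStmt, qrst, cfg]

/-- `testN`: read the answer symbol of `N` (the top of its output stack, which is left in
place: the output stack may coincide with the input stack) and park it on `TMP`. [folklore] -/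
theorem step_testN (g : N.tm.Γ N.tm.k₁) (h : (S N.tm.k₁).head? = some g) :
    (queryTM N).step (cfg N (some (Sum.inr QCtrl.testN)) s S io t) =
      some (cfg N (some (Sum.inr QCtrl.restore)) s S io (N.outputAlphabet g :: t)) := by
  rw [cfg, step_inr]; simp [ctrlStmt, qrst, cfg, h]

/-- `restore` on a nonempty left input stack: move one symbol to the input stack. [folklore] -/
theorem step_restore_cons (g : N.tm.Γ N.kL) (L : List (N.tm.Γ N.kL)) :
    (queryTM N).step (cfg N (some (Sum.inr QCtrl.restore)) s (update S N.kL (g :: L)) io t) =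
      some (cfg N (some (Sum.inr QCtrl.restore)) s
        (update (update S N.kL L) N.tm.k₀
          (N.inputAlphabet.symm (N.leftAlphabet g) :: S N.tm.k₀)) io t) := by
  rw [cfg, step_inr]
  simp [ctrlStmt, qrst, cfg, update_of_ne N.kL_ne_k₀.symm]

/-- `restore` on an empty left input stack: go to `mvN`. [folklore] -/
theorem step_restore_nil :
    (queryTM N).step (cfg N (some (Sum.inr QCtrl.restore)) s (update S N.kL []) io t) =
      some (cfg N (some (Sum.inr QCtrl.mvN)) s (update S N.kL []) io t) := by
  rw [cfg, step_inr]; simp [ctrlStmt, qrst, cfg]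

/-- `mvN` on a nonempty input stack of `N`: move one symbol to `TMP`. [folklore] -/
theorem step_mvN_cons (g : N.tm.Γ N.tm.k₀) (L : List (N.tm.Γ N.tm.k₀)) :
    (queryTM N).step (cfg N (some (Sum.inr QCtrl.mvN)) s (update S N.tm.k₀ (g :: L)) io t) =
      some (cfg N (some (Sum.inr QCtrl.mvN)) s (update S N.tm.k₀ L) io (N.inputAlphabet g :: t)) := by
  rw [cfg, step_inr]; simp [ctrlStmt, qrst, cfg]

/-- `mvN` on an empty input stack of `N`: go to `pourBack`. [folklore] -/
theorem step_mvN_nil :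
    (queryTM N).step (cfg N (some (Sum.inr QCtrl.mvN)) s (update S N.tm.k₀ []) io t) =
      some (cfg N (some (Sum.inr QCtrl.pourBack)) s (update S N.tm.k₀ []) io t) := by
  rw [cfg, step_inr]; simp [ctrlStmt, qrst, cfg]

/-- `pourBack` on nonempty `TMP`: move one symbol to `IO`. [folklore] -/
theorem step_pourBack_cons (b : Bool) :
    (queryTM N).step (cfg N (some (Sum.inr QCtrl.pourBack)) s S io (b :: t)) =
      some (cfg N (some (Sum.inr QCtrl.pourBack)) s S (b :: io) t) := by
  rw [cfg, step_inr]; simp [ctrlStmt, qrst, cfg]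

/-- `pourBack` on empty `TMP`: push the flag `0` and go to `clear`. [folklore] -/
theorem step_pourBack_nil :
    (queryTM N).step (cfg N (some (Sum.inr QCtrl.pourBack)) s S io []) =
      some (cfg N (some (Sum.inr QCtrl.clear)) s S (false :: io) []) := by
  rw [cfg, step_inr]; simp [ctrlStmt, qrst, cfg]

/-- `clear` when some stack of `N` is nonempty: pop every stack once and repeat. [folklore] -/
theorem step_clear_true (h : anyNE (allStacks N) S = true) :
    (queryTM N).step (cfg N (some (Sum.inr QCtrl.clear)) s S io t) =
      some (cfg N (some (Sum.inr QCtrl.clear)) s (popAll (allStacks N) S) io t) := by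
  rw [cfg, step_inr, ctrlStmt, stepAux_clearStmt, h]
  simp [qrst, cfg]

/-- `clear` when every stack of `N` is empty: reset the state and halt. [folklore] -/
theorem step_clear_false (h : anyNE (allStacks N) S = false) :
    (queryTM N).step (cfg N (some (Sum.inr QCtrl.clear)) s S io t) =
      some (cfg N none N.tm.initialState S io t) := by
  rw [cfg, step_inr, ctrlStmt, stepAux_clearStmt, h, popAll_eq_self_of_anyNE_eq_false h]
  simp [cfg]

/-- A step of the embedded machine `N` is a step of the query transducer on the embedded
configuration. [folklore] -/
theorem step_cfgN (a b : N.tm.Cfg) (h : N.tm.step a = some b) :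
    (queryTM N).step (cfgN a) = some (cfgN b) := by
  obtain ⟨_ | l, w, S'⟩ := a
  · simp [FinTM2.step, TM2.step] at h
  · simp only [FinTM2.step, TM2.step] at h
    obtain rfl := Option.some.inj h
    simp only [cfgN, Option.elim]
    rw [step_inl, stepAux_trStmt]
    rfl

end Steps

/-! ### Phases of the query transducer (runs through a predicate) -/

section Phases

variable (P : QCfg N → Prop) (s : N.tm.σ) (S : ∀ k, List (N.tm.Γ k))

/-- `mvQ`: `IO` is poured (reversed) onto `TMP`, then the machine proceeds to `feedN`.
[folklore] -/
theorem mvQ_run : ∀ io t : List Bool,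
    (∀ i₁ i₂, i₁ ++ i₂ = io → P (cfg N (some (Sum.inr QCtrl.mvQ)) s S i₂ (i₁.reverse ++ t))) →
    P (cfg N (some (Sum.inr QCtrl.feedN)) s S [] (io.reverse ++ t)) →
    RunsVia (C := QCfg N) (queryTM N).step P (cfg N (some (Sum.inr QCtrl.mvQ)) s S io t)
      (cfg N (some (Sum.inr QCtrl.feedN)) s S [] (io.reverse ++ t)) := by
  intro io
  induction io with
  | nil =>
    intro t hP hend
    simpa using RunsVia.single (step_mvQ_nil N s S t) (by simpa using hP [] [] rfl) (by simpa using hend)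
  | cons b io ih =>
    intro t hP hend
    have h0 : P (cfg N (some (Sum.inr QCtrl.mvQ)) s S (b :: io) t) := by simpa using hP [] (b :: io) rfl
    have h1 := ih (b :: t)
      (fun i₁ i₂ h => by simpa [List.append_assoc] using hP (b :: i₁) i₂ (by simp [h]))
      (by simpa [List.append_assoc] using hend)
    simpa [List.append_assoc] using RunsVia.step_trans (step_mvQ_cons N s S io t b) h0 h1

/-- `feedN`: `TMP` is poured (reversed, written through `N.inputAlphabet.symm`) on top of the
input stack of `N`, then the embedded machine is started. [folklore] -/
theorem feedN_run (io : List Bool) : ∀ (t : List Bool) (S : ∀ k, List (N.tm.Γ k)),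
    (∀ t₁ t₂, t₁ ++ t₂ = t →
      P (cfg N (some (Sum.inr QCtrl.feedN)) s
        (update S N.tm.k₀ (t₁.reverse.map N.inputAlphabet.symm ++ S N.tm.k₀)) io t₂)) →
    P (cfg N (some (Sum.inl N.tm.main)) s
      (update S N.tm.k₀ (t.reverse.map N.inputAlphabet.symm ++ S N.tm.k₀)) io []) →
    RunsVia (C := QCfg N) (queryTM N).step P (cfg N (some (Sum.inr QCtrl.feedN)) s S io t)
      (cfg N (some (Sum.inl N.tm.main)) s
        (update S N.tm.k₀ (t.reverse.map N.inputAlphabet.symm ++ S N.tm.k₀)) io []) := by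
  intro t
  induction t with
  | nil =>
    intro S hP hend
    have h0 := hP [] [] rfl
    simp only [List.reverse_nil, List.map_nil, List.nil_append, update_eq_self] at h0 hend ⊢
    exact RunsVia.single (step_feedN_nil N s S io) h0 hend
  | cons b t ih =>
    intro S hP hend
    have h0 : P (cfg N (some (Sum.inr QCtrl.feedN)) s S io (b :: t)) := by
      simpa using hP [] (b :: t) rfl
    have h1 := ih (update S N.tm.k₀ (N.inputAlphabet.symm b :: S N.tm.k₀))
      (fun t₁ t₂ h => by
        have := hP (b :: t₁) t₂ (by simp [h])
        simp only [update_idem, update_self]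
        simpa [List.append_assoc] using this)
      (by
        simp only [update_idem, update_self]
        simpa [List.append_assoc] using hend)
    simp only [update_idem, update_self] at h1
    simpa [List.append_assoc] using RunsVia.step_trans (step_feedN_cons N s S io t b) h0 h1

/-- `restore`: the left input stack `kL` of `N` is poured (through `N.leftAlphabet` and
`N.inputAlphabet.symm`) on top of its input stack, then the machine proceeds to `mvN`.
[folklore] -/
theorem restore_run (io t : List Bool) : ∀ (L : List (N.tm.Γ N.kL)) (S : ∀ k, List (N.tm.Γ k)),
    (∀ L₁ L₂, L₁ ++ L₂ = L →
      P (cfg N (some (Sum.inr QCtrl.restore)) s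
        (update (update S N.kL L₂) N.tm.k₀
          ((L₁.map fun g => N.inputAlphabet.symm (N.leftAlphabet g)).reverse ++ S N.tm.k₀)) io t)) →
    P (cfg N (some (Sum.inr QCtrl.mvN)) s
      (update (update S N.kL []) N.tm.k₀
        ((L.map fun g => N.inputAlphabet.symm (N.leftAlphabet g)).reverse ++ S N.tm.k₀)) io t) →
    RunsVia (C := QCfg N) (queryTM N).step P
      (cfg N (some (Sum.inr QCtrl.restore)) s (update S N.kL L) io t)
      (cfg N (some (Sum.inr QCtrl.mvN)) s
        (update (update S N.kL []) N.tm.k₀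
          ((L.map fun g => N.inputAlphabet.symm (N.leftAlphabet g)).reverse ++ S N.tm.k₀)) io t) := by
  have hne : N.tm.k₀ ≠ N.kL := N.kL_ne_k₀.symm
  intro L
  induction L with
  | nil =>
    intro S hP hend
    have h0 := hP [] [] rfl
    simp only [List.map_nil, List.reverse_nil, List.nil_append] at h0 hend ⊢
    have e0 : update (update S N.kL []) N.tm.k₀ (S N.tm.k₀) = update S N.kL [] :=
      update_eq_self_iff.2 (update_of_ne hne [] S).symm
    rw [e0] at h0 hend ⊢
    exact RunsVia.single (step_restore_nil N s S io t) h0 hend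
  | cons g L ih =>
    intro S hP hend
    have h0 : P (cfg N (some (Sum.inr QCtrl.restore)) s (update S N.kL (g :: L)) io t) := by
      have := hP [] (g :: L) rfl
      simp only [List.map_nil, List.reverse_nil, List.nil_append] at this
      have e0 : update (update S N.kL (g :: L)) N.tm.k₀ (S N.tm.k₀) = update S N.kL (g :: L) :=
        update_eq_self_iff.2 (update_of_ne hne (g :: L) S).symm
      rwa [e0] at this
    -- the configuration after one step, rewritten as an update at `kL` of a new base family
    set S₁ : ∀ k, List (N.tm.Γ k) :=
      update S N.tm.k₀ (N.inputAlphabet.symm (N.leftAlphabet g) :: S N.tm.k₀) with hS₁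
    have e1 : update (update S N.kL L) N.tm.k₀ (N.inputAlphabet.symm (N.leftAlphabet g) :: S N.tm.k₀) =
        update S₁ N.kL L := by
      rw [hS₁, update_comm hne]
    have key : ∀ (L₂ : List (N.tm.Γ N.kL)) (X : List (N.tm.Γ N.tm.k₀)),
        update (update S₁ N.kL L₂) N.tm.k₀ (X ++ S₁ N.tm.k₀) =
          update (update S N.kL L₂) N.tm.k₀
            (X ++ [N.inputAlphabet.symm (N.leftAlphabet g)] ++ S N.tm.k₀) := by
      intro L₂ X
      rw [hS₁, update_self, update_comm hne, update_idem]
      simp [List.append_assoc]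
    have h1 := ih S₁
      (fun L₁ L₂ h => by
        have := hP (g :: L₁) L₂ (by simp [h])
        rw [key]
        simpa [List.append_assoc] using this)
      (by
        rw [key]
        simpa [List.append_assoc] using hend)
    rw [key] at h1
    have hstep := step_restore_cons N s S io t g L
    rw [e1] at hstep
    simpa [List.append_assoc] using RunsVia.step_trans hstep h0 h1

/-- `mvN`: the input stack of `N` is poured (reversed, read through `N.inputAlphabet`) onto
`TMP`, then the machine proceeds to `pourBack`. [folklore] -/
theorem mvN_run (io : List Bool) : ∀ (L : List (N.tm.Γ N.tm.k₀)) (t : List Bool),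
    (∀ L₁ L₂, L₁ ++ L₂ = L →
      P (cfg N (some (Sum.inr QCtrl.mvN)) s (update S N.tm.k₀ L₂) io
        ((L₁.map N.inputAlphabet).reverse ++ t))) →
    P (cfg N (some (Sum.inr QCtrl.pourBack)) s (update S N.tm.k₀ []) io
      ((L.map N.inputAlphabet).reverse ++ t)) →
    RunsVia (C := QCfg N) (queryTM N).step P (cfg N (some (Sum.inr QCtrl.mvN)) s (update S N.tm.k₀ L) io t)
      (cfg N (some (Sum.inr QCtrl.pourBack)) s (update S N.tm.k₀ []) io
        ((L.map N.inputAlphabet).reverse ++ t)) := by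
  intro L
  induction L with
  | nil =>
    intro t hP hend
    simpa using RunsVia.single (step_mvN_nil N s S io t) (by simpa using hP [] [] rfl) (by simpa using hend)
  | cons g L ih =>
    intro t hP hend
    have h0 : P (cfg N (some (Sum.inr QCtrl.mvN)) s (update S N.tm.k₀ (g :: L)) io t) := by
      simpa using hP [] (g :: L) rfl
    have h1 := ih (N.inputAlphabet g :: t)
      (fun L₁ L₂ h => by simpa [List.append_assoc] using hP (g :: L₁) L₂ (by simp [h]))
      (by simpa [List.append_assoc] using hend)
    simpa [List.append_assoc] using RunsVia.step_trans (step_mvN_cons N s S io t g L) h0 h1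

/-- `pourBack`: `TMP` is poured (reversed) onto `IO`, then the flag `0` is pushed and the machine
proceeds to `clear`. [folklore] -/
theorem pourBack_run : ∀ t io : List Bool,
    (∀ t₁ t₂, t₁ ++ t₂ = t → P (cfg N (some (Sum.inr QCtrl.pourBack)) s S (t₁.reverse ++ io) t₂)) →
    P (cfg N (some (Sum.inr QCtrl.clear)) s S (false :: (t.reverse ++ io)) []) →
    RunsVia (C := QCfg N) (queryTM N).step P (cfg N (some (Sum.inr QCtrl.pourBack)) s S io t)
      (cfg N (some (Sum.inr QCtrl.clear)) s S (false :: (t.reverse ++ io)) []) := by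
  intro t
  induction t with
  | nil =>
    intro io hP hend
    simpa using RunsVia.single (step_pourBack_nil N s S io) (by simpa using hP [] [] rfl) (by simpa using hend)
  | cons b t ih =>
    intro io hP hend
    have h0 : P (cfg N (some (Sum.inr QCtrl.pourBack)) s S io (b :: t)) := by simpa using hP [] (b :: t) rfl
    have h1 := ih (b :: io)
      (fun t₁ t₂ h => by simpa [List.append_assoc] using hP (b :: t₁) t₂ (by simp [h]))
      (by simpa [List.append_assoc] using hend)
    simpa [List.append_assoc] using RunsVia.step_trans (step_pourBack_cons N s S io t b) h0 h1

/-- `clear`: from any contents of the stacks of `N`, the machine empties them all, resets the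
state and halts; the run stays inside `P` if `P` holds for every `clear` configuration whose
stacks are pointwise no longer than the given ones, and for the halting configuration.
[folklore] -/
theorem clear_run (io t : List Bool)
    (hP : ∀ S' : ∀ k, List (N.tm.Γ k), (∀ k, (S' k).length ≤ (S k).length) →
      P (cfg N (some (Sum.inr QCtrl.clear)) s S' io t))
    (hend : P (cfg N none N.tm.initialState (botStk N.tm) io t)) :
    RunsVia (C := QCfg N) (queryTM N).step P (cfg N (some (Sum.inr QCtrl.clear)) s S io t)
      (cfg N none N.tm.initialState (botStk N.tm) io t) := by
  letI := N.tm.kFin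
  -- strong induction on the total length of the stacks of `N`
  suffices H : ∀ (n : ℕ) (S' : ∀ k, List (N.tm.Γ k)), ∑ k, (S' k).length ≤ n →
      (∀ k, (S' k).length ≤ (S k).length) →
      RunsVia (C := QCfg N) (queryTM N).step P (cfg N (some (Sum.inr QCtrl.clear)) s S' io t)
        (cfg N none N.tm.initialState (botStk N.tm) io t) from
    H _ S le_rfl (fun k => le_rfl)
  intro n
  induction n with
  | zero =>
    intro S' hn hS'
    have hall : ∀ k, S' k = [] := fun k =>
      List.eq_nil_of_length_eq_zero (Nat.eq_zero_of_le_zero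
        ((Finset.single_le_sum (fun k _ => Nat.zero_le _) (Finset.mem_univ k)).trans hn))
    have hS'eq : S' = botStk N.tm := funext hall
    have hfalse : anyNE (allStacks N) S' = false := by
      by_contra h
      rw [Bool.not_eq_false] at h
      have := sum_length_popAll_lt (ks := allStacks N) h
      rw [hS'eq] at this
      simp at this
    refine RunsVia.single ?_ (hP S' hS') hend
    rw [step_clear_false N s S' io t hfalse, hS'eq]
  | succ n ih =>
    intro S' hn hS'
    cases h : anyNE (allStacks N) S' with
    | false =>
      have hall : ∀ k, S' k = [] := fun k => eq_nil_of_anyNE_eq_false h (mem_allStacks N k)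
      have hS'eq : S' = botStk N.tm := funext hall
      refine RunsVia.single ?_ (hP S' hS') hend
      rw [step_clear_false N s S' io t h, hS'eq]
    | true =>
      have hlt := sum_length_popAll_lt (ks := allStacks N) h
      refine RunsVia.step_trans (step_clear_true N s S' io t h) (hP S' hS') (ih _ (by omega) ?_)
      exact fun k => (length_popAll_le _ _ k).trans (hS' k)

/-- A prefix of a defined run is defined (re-export of `SpaceLoop.exists_iterate_of_le` for the
reader). [folklore] -/
theorem runN {n : ℕ} {a b : N.tm.Cfg} (h : (flip bind N.tm.step)^[n] (some a) = some b)
    (hP : ∀ j ≤ n, ∀ d, (flip bind N.tm.step)^[j] (some a) = some d → P (cfgN d)) :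
    RunsVia (C := QCfg N) (queryTM N).step P (cfgN a) (cfgN b) := by
  refine ⟨n, iterate_bind_map N.tm.step (queryTM N).step cfgN
    (fun c d hcd => step_cfgN N c d hcd) n a b h, fun i hi c hc => ?_⟩
  obtain ⟨d, hd⟩ := exists_iterate_of_le h hi
  have := iterate_bind_map N.tm.step (queryTM N).step cfgN
    (fun c d hcd => step_cfgN N c d hcd) i a d hd
  have e : some (cfgN d) = some c := this.symm.trans hc
  obtain rfl := Option.some.inj e
  exact hP i hi d hd

end Phases

end Bundled

end SpaceQuery

end Literature.Computability.Complexity
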